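import Summits.BirchSwinnertonDyer.BirchSwinnertonDyer.Theorems.AlignedTransportAtTwoMainConjectureOfRankZeroBSDAtTwoHalfDescentLayerIndexGrowthSelmer
import Literature.NumberTheory.EllipticCurves.IwasawaDualLayerCoinvariantsProofs
import Literature.NumberTheory.EllipticCurves.IwasawaNakayamaProofs
import HarnessLib

/-!
# Route `AlignedTransportAtTwo`, crux C2 `MainConjectureOfRankZeroBSDAtTwo` (stmt-BirchSwinnertonDyer-22298):
# THE GROWTH NUMBER WITHOUT GREENBERG 4.14, VI — PONTRYAGIN DUAL OF THE GROWTH NUMBER, ANY RANK: `#(ω_nX/ω_{n+1}X) = #((conj_γ^{pⁿ} − 1)·Sel_∞^{conj_γ^{p^{n+1}} = 1})`,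
# so `0 < #((conj_γ^{pⁿ} − 1)·Sel_{p^∞}(E/K_∞)^{Γ_{n+1}}) < p^{pⁿ(p−1)}` at ANY ONE layer ⟹ `μ(X(E/K_∞)) = 0` — a certificate that survives INFINITE `#Sel_∞^{Γ_n}`
# (towers of positive rank), and is complete with NO hypothesis on the tower

HONEST FRAMING (cell `bsd-f1-sign2`, WIDTH-5 attached prover seat `bsd-line-att-p5` gen 56 on line `birth` of the lead `bsd-line-att-p2`;
`--supports` stmt-BirchSwinnertonDyer-22298, closes nothing; BSD is NOT proved by any of this; the crux C2, its verdict «blocked-on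
`Rank1Residual.GreenbergMuConjectureIrreducible`» and every registered stub (P / T / Kμ / LimDoor / MuIneqʳ / PFμ⁺) are untouched). THEOREMS ONLY — no `def`,
no instance, no named fact, no `sorry`. Route-independent (any number field `K`, any `ℤ_p`-extension, any Pontryagin-dual datum). Sequel of this gen's
`…HalfDescentLayerIndexGrowth` (`p^{pⁿ(p−1)μ(X)} ∣ g_n`, `0 < g_n < p^{pⁿ(p−1)} ⟹ μ(X) = 0` for EVERY f.g. torsion `X`, `g_n = #(ω_nX/ω_{n+1}X)`) and
`…GrowthSelmer` (§1: `μ(X) = 0 ⟺ ∃ n, 0 < g_n < p^{pⁿ(p−1)}` with NO tower hypothesis), using the tree's axiomatic Pontryagin duality `IwasawaDual.IsDualPair`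
(`IwasawaNakayamaProofs`, `IwasawaDualLayerCoinvariantsProofs`: `X/fX ≃ Hom(ker g, ℚ/ℤ)` when `f` acts as precomposition by `g`; `ω_n ↔ conj_γ^{pⁿ} − 1`).

THE POINT. The ratio/absolute certificates of files I–V read `#Sel_∞^{Γ_n} = #(X/ω_nX)`, which is INFINITE in a tower of positive rank (`T ∣ char X`), where they say
nothing. The growth number itself is the order of a SUBQUOTIENT `ω_nX/ω_{n+1}X`, whose Pontryagin dual is an honest subgroup of the limit Selmer group:
* §1 (axiomatic duality, any dual pair `(X, S, toDual)`): ★★ `natCard_smul_top_quotient_eq_natCard_map` — if `f₁` acts as precomposition by `g₁` and `f₁f₂` by `g₁₂`, then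
  **`#(f₁X / f₂·f₁X) = #(g₁(ker g₁₂))`** (restriction of `X/f₁f₂X ≃ Hom(ker g₁₂, ℚ/ℤ)` to the image of `f₁X`: its characters are exactly those factoring through
  `g₁ : ker g₁₂ ↠ g₁(ker g₁₂)`, and `#Hom(A, ℚ/ℤ) = #A`).
* §2 (Selmer): ★★ `natCard_growth_eq_natCard_map` **`g_n(X(E/K_∞)) = #((conj_γ^{pⁿ} − 1)·{s ∈ Sel_∞ : conj_γ^{p^{n+1}} s = s})`** — the image of `γ^{pⁿ} − 1` on the
  `Γ_{n+1}`-invariants (for `p = 2`: the image of `σ − 1`, `σ = conj_γ^{2ⁿ}` the involution of the relative quadratic layer, i.e. `(σ − 1)·Sel_∞^{Γ_{n+1}}`);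
  `natCard_endInvariants_succ_eq_mul` (`#Sel_∞^{φ^{p^{n+1}}=1} = #Sel_∞^{φ^{pⁿ}=1} · #((φ^{pⁿ}−1)·Sel_∞^{φ^{p^{n+1}}=1})`, `Nat.card`);
  ★★★ `mu_eq_zero_of_natCard_map_endInvariants_pos_lt` — **`0 < #((conj_γ^{pⁿ} − 1)·Sel_∞^{Γ_{n+1}}) < p^{pⁿ(p−1)}` at ANY ONE `n` ⟹ `μ(X(E/K_∞)) = 0`**, for EVERY
  dual datum with `X` finitely generated torsion, ANY rank; ★★ `pow_dvd_natCard_map_endInvariants` (`p^{pⁿ(p−1)μ} ∣` that order, unconditionally);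
  ★★★ `mu_eq_zero_iff_exists_natCard_map_endInvariants_pos_lt` — **COMPLETE with NO hypothesis on the tower**: `μ = 0 ⟺ ∃ n, 0 < #((conj_γ^{pⁿ} − 1)·Sel_∞^{Γ_{n+1}}) < p^{pⁿ(p−1)}`.
Reading for C2 (`p = 2`, rank `0`): the same certificate as file III (there `#Sel_∞^{Γ_n}` is finite and the image has order `#Sel_∞^{Γ_{n+1}}/#Sel_∞^{Γ_n}`). Reading
beyond C2 (rank-one settings of the cell, e.g. C3′-type data, or any `E/K` with `corank Sel_∞^{Γ} ≥ 1`): the ONLY one-layer `μ = 0` certificate of the lineage that is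
not vacuous there. What is NOT claimed: nothing about any curve; no order computed. Memo `Cruxes/MainConjectureOfRankZeroBSDAtTwo/LAYER-GROWTH-att-p5-g56.md`.

References: R. Greenberg, LNM 1716 (1999), §1 pp. 60–65 (`X = Hom(Sel_∞, ℚ_p/ℤ_p)`, `X/TX` dual to `Sel^Γ`), Thm. 1.10, Conj. 1.11 [GreenbergLNM1716]; L. Washington,
GTM 83, §13.3 Thm. 13.13, §13.4 [Washington1997]; B. Mazur, Invent. Math. 18 (1972) §6 [Mazur1972].
-/

set_option linter.dupNamespace false
set_option autoImplicit false

noncomputable section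

open scoped Classical AddSubgroup Polynomial

universe u

namespace Summit.BirchSwinnertonDyer.BirchSwinnertonDyer.Theorems.AlignedTransportAtTwoHalfDescentLayerIndexGrowthDual

open WeierstrassCurve Literature.NumberTheory.EllipticCurves Literature.NumberTheory.EllipticCurves.IwasawaDual
  Literature.NumberTheory.EllipticCurves.PontryaginCard
  Literature.NumberTheory.EllipticCurves.IwasawaAlgebra
  Summit.BirchSwinnertonDyer.Rank1Residual.X1.MuLambda
  Summit.BirchSwinnertonDyer.Rank1Residual.Iwasawa
  Summit.BirchSwinnertonDyer.BirchSwinnertonDyer.Theorems.DefectPrime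
  Summit.BirchSwinnertonDyer.BirchSwinnertonDyer.Theorems.AlignedTransportAtTwoCyclotomicLayerPrime
  Summit.BirchSwinnertonDyer.BirchSwinnertonDyer.Theorems.AlignedTransportAtTwoHalfDescentLayerIndexGrowth
  Summit.BirchSwinnertonDyer.BirchSwinnertonDyer.Theorems.AlignedTransportAtTwoHalfDescentLayerIndexGrowthSelmer

/-! ## §1 Pontryagin dual of a subquotient `f₁X / f₁f₂X` -/

section Dual

variable {p : ℕ} [Fact p.Prime] {S : Type*} [AddCommGroup S] {ψ : AddMonoid.End S}
  {X : Type*} [AddCommGroup X] [Module (PowerSeries ℤ_[p]) X] {toDual : X →+ (S →+ AddCircle (1 : ℚ))}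

/-- ★★ **`#(f₁X / f₂·f₁X) = #(g₁(ker g₁₂))`** for a dual pair `toDual : X ≃ Hom(S, ℚ/ℤ)` in which `f₁ ∈ Λ` acts as precomposition by `g₁ ∈ End S` and `f₁f₂` by `g₁₂`:
under `X/f₁f₂X ≃ Hom(ker g₁₂, ℚ/ℤ)` (tree `IsDualPair.exists_quotient_addEquiv_of_smul`) the image of `f₁X` is the group of characters of `ker g₁₂` that factor through the
surjection `g₁ : ker g₁₂ ↠ g₁(ker g₁₂)`, which is `≃ Hom(g₁(ker g₁₂), ℚ/ℤ)` (characters of a subgroup of `S` extend to `S`, `ℚ/ℤ` injective); `#Hom(A, ℚ/ℤ) = #A`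
(`Nat.card`, both sides `0` when infinite). [cite: GreenbergLNM1716, §1 pp. 60–65] [cite: Washington1997, §13.4] -/
theorem natCard_smul_top_quotient_eq_natCard_map (h : IsDualPair p ψ toDual) {f₁ f₂ : PowerSeries ℤ_[p]} {g₁ g₁₂ : AddMonoid.End S}
    (hfg₁ : ∀ (x : X) (s : S), toDual (f₁ • x) s = toDual x (g₁ s)) (hfg₁₂ : ∀ (x : X) (s : S), toDual ((f₁ * f₂) • x) s = toDual x (g₁₂ s)) :
    Nat.card (↥(Ideal.span {f₁} • ⊤ : Submodule (PowerSeries ℤ_[p]) X) ⧸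
        (Ideal.span {f₂} • ⊤ : Submodule (PowerSeries ℤ_[p]) ↥(Ideal.span {f₁} • ⊤ : Submodule (PowerSeries ℤ_[p]) X))) =
      Nat.card ↥((endInvariants g₁₂).map (AddMonoidHomClass.toAddMonoidHom g₁)) := by
  set A : Submodule (PowerSeries ℤ_[p]) X := Ideal.span {f₁} • ⊤ with hA
  set C : Submodule (PowerSeries ℤ_[p]) X := Ideal.span {f₁ * f₂} • ⊤ with hC
  set B : Submodule (PowerSeries ℤ_[p]) A := Ideal.span {f₂} • ⊤ with hB
  set K : AddSubgroup S := endInvariants g₁₂ with hK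
  set Ag : AddSubgroup S := K.map (AddMonoidHomClass.toAddMonoidHom g₁) with hAg
  have hmemA : ∀ x : X, x ∈ A ↔ ∃ y : X, x = f₁ • y := fun x ↦ by
    rw [hA, Submodule.ideal_span_singleton_smul, Submodule.mem_smul_pointwise_iff_exists]
    exact ⟨fun ⟨y, _, hy⟩ ↦ ⟨y, hy.symm⟩, fun ⟨y, hy⟩ ↦ ⟨y, Submodule.mem_top, hy.symm⟩⟩
  -- step 1: `#(A/B) = #(image of A in X/C)`
  have hBC : B.map A.subtype = C := map_subtype_smul_top_smul_top f₁ f₂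
  set ι : A →ₗ[PowerSeries ℤ_[p]] X ⧸ C := C.mkQ.comp A.subtype with hι
  have hι_range : LinearMap.range ι = A.map C.mkQ := by rw [hι, LinearMap.range_comp, Submodule.range_subtype]
  have hι_ker : LinearMap.ker ι = B := by
    rw [hι, LinearMap.ker_comp, Submodule.ker_mkQ, ← hBC, Submodule.comap_map_eq_of_injective (Submodule.injective_subtype A)]
  have h1 : Nat.card (A ⧸ B) = Nat.card ↥(A.map C.mkQ) := by
    rw [← hι_range, ← Nat.card_congr ι.quotKerEquivRange.toEquiv, Nat.card_congr (Submodule.quotEquivOfEq _ _ hι_ker).toEquiv]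
  -- step 2: `Ψ : X/C ≃+ Hom(K, ℚ/ℤ)`; `r : K ↠ Ag`; `π = (· ∘ r)` injective
  obtain ⟨Ψ, hΨ⟩ := h.exists_quotient_addEquiv_of_smul hfg₁₂
  set r : ↥K →+ ↥Ag := ((AddMonoidHomClass.toAddMonoidHom g₁).comp K.subtype).codRestrict Ag
    (fun k ↦ AddSubgroup.mem_map_of_mem _ k.2) with hr_def
  have hr_apply : ∀ k : K, (r k : S) = g₁ k := fun _ ↦ rfl
  have hr : Function.Surjective r := by
    rintro ⟨a, ha⟩
    obtain ⟨k, hk, rfl⟩ := AddSubgroup.mem_map.mp ha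
    exact ⟨⟨k, hk⟩, rfl⟩
  let π : CharacterModule ↥Ag → CharacterModule ↥K := fun χ ↦ χ.comp r
  have hπ_apply : ∀ (χ : CharacterModule ↥Ag) (k : K), π χ k = χ (r k) := fun _ _ ↦ rfl
  have hπ : Function.Injective π := by
    intro χ χ' hχ
    refine CharacterModule.ext (A := ↥Ag) fun a ↦ ?_
    obtain ⟨k, rfl⟩ := hr a
    rw [← hπ_apply, ← hπ_apply, hχ]
  -- step 3: `Ψ(image of A) = range π`
  have key : ∀ y : X, Ψ (C.mkQ (f₁ • y)) = π ((toDual y).comp Ag.subtype) := by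
    intro y
    refine CharacterModule.ext (A := ↥K) fun k ↦ ?_
    rw [Submodule.mkQ_apply, hΨ, hfg₁, hπ_apply]
    rfl
  have h3 : (Ψ : X ⧸ C → CharacterModule ↥K) '' ((A.map C.mkQ : Submodule (PowerSeries ℤ_[p]) (X ⧸ C)) : Set (X ⧸ C)) = Set.range π := by
    ext χ
    constructor
    · rintro ⟨q, hq, rfl⟩
      obtain ⟨a, ha, rfl⟩ := Submodule.mem_map.mp hq
      obtain ⟨y, rfl⟩ := (hmemA a).mp ha
      exact ⟨(toDual y).comp Ag.subtype, (key y).symm⟩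
    · rintro ⟨χ, rfl⟩
      obtain ⟨χS, hχS⟩ := CharacterModule.dual_surjective_of_injective (Ag.subtype.toIntLinearMap) (fun a b hab ↦ Subtype.ext hab) χ
      have hχS' : ∀ a : Ag, χS a = χ a := fun a ↦ by
        have := DFunLike.congr_fun hχS a
        rw [CharacterModule.dual_apply] at this
        exact this
      obtain ⟨y, hy⟩ := h.bijective.2 χS
      refine ⟨C.mkQ (f₁ • y), ⟨f₁ • y, (hmemA _).mpr ⟨y, rfl⟩, rfl⟩, ?_⟩
      rw [key y, hy]
      exact congrArg π (CharacterModule.ext (A := ↥Ag) fun a ↦ hχS' a)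
  -- step 4: count
  calc Nat.card (A ⧸ B) = Nat.card ↥(A.map C.mkQ) := h1
    _ = Nat.card ((Ψ : X ⧸ C → CharacterModule ↥K) '' ((A.map C.mkQ : Submodule (PowerSeries ℤ_[p]) (X ⧸ C)) : Set (X ⧸ C))) :=
        (Nat.card_image_of_injective Ψ.injective _).symm
    _ = Nat.card (Set.range π) := by rw [h3]
    _ = Nat.card (CharacterModule ↥Ag) := Nat.card_range_of_injective hπ
    _ = Nat.card ↥Ag := natCard_characterModule _

end Dual

/-! ## §2 Selmer: the growth number is the image of `conj_γ^{pⁿ} − 1` on the `Γ_{n+1}`-invariants -/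

section Selmer

variable {K : Type u} [Field K] [NumberField K] (W : WeierstrassCurve K) {p : ℕ} [hp : Fact p.Prime] (κ : ZpExtension K p)
  {γ : Field.absoluteGaloisGroup K}

/-- ★★ **`g_n(X(E/K_∞)) = #((conj_γ^{pⁿ} − 1)·{s ∈ Sel_{p^∞}(E/K_∞) : conj_γ^{p^{n+1}} s = s})`** for EVERY Pontryagin-dual datum and every `n` (`Nat.card`): the growth
number `#(ω_nX/ω_{n+1}X)` is the order of the image of `γ^{pⁿ} − 1` on the `Γ_{n+1}`-invariants of the limit Selmer group (`ω_n ↔ conj_γ^{pⁿ} − 1`, `ω_{n+1} = ω_nΨ_n`).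
[cite: GreenbergLNM1716, §1 pp. 60–65 and §3 p. 85] -/
theorem natCard_growth_eq_natCard_map (hγ : κ.IsTopGenerator γ) (D : W.SelmerDualData κ γ) (n : ℕ) :
    Nat.card (↥(Ideal.span {((1 + PowerSeries.X : PowerSeries ℤ_[p]) ^ (p ^ n) - 1 : IwasawaAlgebra p)} • ⊤ : Submodule (IwasawaAlgebra p) D.X) ⧸
        (Ideal.span {(((Polynomial.cyclotomic (p ^ (n + 1)) ℤ_[p]).comp (Polynomial.X + 1) : ℤ_[p][X]) : IwasawaAlgebra p)} • ⊤ :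
          Submodule (IwasawaAlgebra p) ↥(Ideal.span {((1 + PowerSeries.X : PowerSeries ℤ_[p]) ^ (p ^ n) - 1 : IwasawaAlgebra p)} • ⊤ :
            Submodule (IwasawaAlgebra p) D.X))) =
      Nat.card ↥((endInvariants ((W.conjSelmerInfty κ γ) ^ (p ^ (n + 1)) - 1)).map
        (AddMonoidHomClass.toAddMonoidHom ((W.conjSelmerInfty κ γ) ^ (p ^ n) - 1))) := by
  have h := D.isDualPair W hγ
  have h12 : ∀ (x : D.X) (s : W.selmerInfty κ),
      D.toDual (((((1 + PowerSeries.X : PowerSeries ℤ_[p]) ^ (p ^ n) - 1 : IwasawaAlgebra p)) *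
        ((((Polynomial.cyclotomic (p ^ (n + 1)) ℤ_[p]).comp (Polynomial.X + 1) : ℤ_[p][X]) : IwasawaAlgebra p))) • x) s =
        D.toDual x ((((W.conjSelmerInfty κ γ) ^ (p ^ (n + 1)) - 1)) s) := by
    intro x s
    rw [omega_mul_cyclotomicLayer p n]
    exact h.toDual_omega_smul (n + 1) x s
  exact natCard_smul_top_quotient_eq_natCard_map h (h.toDual_omega_smul n) h12

/-- **`#Sel_∞^{φ^{p^{n+1}} = 1} = #Sel_∞^{φ^{pⁿ} = 1} · #((φ^{pⁿ} − 1)·Sel_∞^{φ^{p^{n+1}} = 1})`** (`φ = conj_γ`; `Nat.card`, every dual datum): the tree's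
`#(X/ω_mX) = #Sel_∞^{φ^{p^m} = 1}` at `m = n, n+1` and file I's `#(X/ω_{n+1}X) = #(X/ω_nX)·g_n`. [cite: GreenbergLNM1716, §1 p. 62 and §3 p. 85] -/
theorem natCard_endInvariants_succ_eq_mul (hγ : κ.IsTopGenerator γ) (D : W.SelmerDualData κ γ) (n : ℕ) :
    Nat.card ↥(endInvariants ((W.conjSelmerInfty κ γ) ^ (p ^ (n + 1)) - 1)) =
      Nat.card ↥(endInvariants ((W.conjSelmerInfty κ γ) ^ (p ^ n) - 1)) *
        Nat.card ↥((endInvariants ((W.conjSelmerInfty κ γ) ^ (p ^ (n + 1)) - 1)).map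
          (AddMonoidHomClass.toAddMonoidHom ((W.conjSelmerInfty κ γ) ^ (p ^ n) - 1))) := by
  have h := D.isDualPair W hγ
  rw [← h.natCard_layerCoinvariants (n + 1), ← h.natCard_layerCoinvariants n, ← natCard_growth_eq_natCard_map W κ hγ D n]
  exact natCard_quotient_omega_succ_eq_mul_growth (M := D.X) n

/-- ★★ **`p^{pⁿ(p−1)·μ(X(E/K_∞))} ∣ #((conj_γ^{pⁿ} − 1)·Sel_∞^{Γ_{n+1}})`** for EVERY dual datum with `X` finitely generated torsion, EVERY `n`, ANY rank.
[cite: GreenbergLNM1716, Thm. 1.10 and Conj. 1.11] [cite: Washington1997, §13.3 Thm. 13.13] -/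
theorem pow_dvd_natCard_map_endInvariants (hγ : κ.IsTopGenerator γ) (D : W.SelmerDualData κ γ) [Module.Finite (IwasawaAlgebra p) D.X]
    (hD : D.IsTorsion) (n : ℕ) :
    p ^ (p ^ n * (p - 1) * D.mu) ∣
      Nat.card ↥((endInvariants ((W.conjSelmerInfty κ γ) ^ (p ^ (n + 1)) - 1)).map
        (AddMonoidHomClass.toAddMonoidHom ((W.conjSelmerInfty κ γ) ^ (p ^ n) - 1))) := by
  rw [← natCard_growth_eq_natCard_map W κ hγ D n]
  exact pow_dvd_natCard_growth (M := D.X) hD n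

/-- ★★★ **`μ = 0` FROM ONE SMALL IMAGE, ANY RANK.** `E/K`, `κ` any `ℤ_p`-extension with topological generator `γ`, `D` any Pontryagin-dual datum with `X` finitely
generated torsion. If at SOME `n`: **`0 < #((conj_γ^{pⁿ} − 1)·Sel_{p^∞}(E/K_∞)^{Γ_{n+1}}) < p^{pⁿ(p−1)}`**, then **`μ(X(E/K_∞)) = 0`**. Unlike the invariants/ratio certificates
this one is NOT vacuous when `#Sel_∞^{Γ_n}` is infinite (towers of positive rank). [cite: GreenbergLNM1716, Conj. 1.11 and §1 pp. 60–65] [cite: Washington1997, §13.3 Thm. 13.13] -/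
theorem mu_eq_zero_of_natCard_map_endInvariants_pos_lt (hγ : κ.IsTopGenerator γ) (D : W.SelmerDualData κ γ) [Module.Finite (IwasawaAlgebra p) D.X]
    (hD : D.IsTorsion) {n : ℕ}
    (hpos : 0 < Nat.card ↥((endInvariants ((W.conjSelmerInfty κ γ) ^ (p ^ (n + 1)) - 1)).map
      (AddMonoidHomClass.toAddMonoidHom ((W.conjSelmerInfty κ γ) ^ (p ^ n) - 1))))
    (hlt : Nat.card ↥((endInvariants ((W.conjSelmerInfty κ γ) ^ (p ^ (n + 1)) - 1)).map
      (AddMonoidHomClass.toAddMonoidHom ((W.conjSelmerInfty κ γ) ^ (p ^ n) - 1))) < p ^ (p ^ n * (p - 1))) : D.mu = 0 := by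
  rw [← natCard_growth_eq_natCard_map W κ hγ D n] at hpos hlt
  exact muInvariant_eq_zero_of_natCard_growth_pos_lt (M := D.X) hD hpos hlt

/-- ★★★ **COMPLETE WITH NO HYPOTHESIS ON THE TOWER: `μ(X(E/K_∞)) = 0 ⟺ ∃ n, 0 < #((conj_γ^{pⁿ} − 1)·Sel_∞^{Γ_{n+1}}) < p^{pⁿ(p−1)}`** for EVERY dual datum with `X` finitely
generated torsion (any rank, any finite submodule). [cite: GreenbergLNM1716, Thm. 1.10 and Conj. 1.11] [cite: Washington1997, §13.3 Thm. 13.13] -/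
theorem mu_eq_zero_iff_exists_natCard_map_endInvariants_pos_lt (hγ : κ.IsTopGenerator γ) (D : W.SelmerDualData κ γ) [Module.Finite (IwasawaAlgebra p) D.X]
    (hD : D.IsTorsion) :
    D.mu = 0 ↔ ∃ n : ℕ,
      0 < Nat.card ↥((endInvariants ((W.conjSelmerInfty κ γ) ^ (p ^ (n + 1)) - 1)).map
        (AddMonoidHomClass.toAddMonoidHom ((W.conjSelmerInfty κ γ) ^ (p ^ n) - 1))) ∧
      Nat.card ↥((endInvariants ((W.conjSelmerInfty κ γ) ^ (p ^ (n + 1)) - 1)).map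
        (AddMonoidHomClass.toAddMonoidHom ((W.conjSelmerInfty κ γ) ^ (p ^ n) - 1))) < p ^ (p ^ n * (p - 1)) := by
  simp only [← natCard_growth_eq_natCard_map W κ hγ D]
  exact muInvariant_eq_zero_iff_exists_natCard_growth_pos_lt (M := D.X) hD

end Selmer

end Summit.BirchSwinnertonDyer.BirchSwinnertonDyer.Theorems.AlignedTransportAtTwoHalfDescentLayerIndexGrowthDual

end
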